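import Literature.Computability.Complexity.HardcoreInapproximabilitySSCSlice
import Literature.Computability.Complexity.HardcoreInapproximabilityPlantedLower
import Literature.Computability.Complexity.HardcoreInapproximabilitySecondMomentLink
import Literature.Computability.Complexity.HardcoreInapproximabilitySecondMomentLimit
import Literature.Computability.Complexity.HardcoreInapproximabilityThm310
import Literature.Computability.Complexity.HardcoreInapproximabilityAssembly
import HarnessLib

/-!
# Sly's gadget theorem, unconditionally: `slyGadgetReduction_holds`

Allan Sly, *Computational transition at the uniqueness threshold*, FOCS 2010 (arXiv:1005.5584),
Theorem 2.1 / Lemma 2.2 in the form `slyGadgetReduction` of `HardcoreInapproximability`.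

`slyGadgetReduction_of_thm310` (`HardcoreInapproximabilityAssembly`) reduced the statement to Sly's
Theorem 3.10 (pointwise lower tail of the phase partition functions of the random bipartite core,
counting form).  Here Theorem 3.10 is proved (`sly_thm310`): the per-slice lower tail of Lemma 3.9
(`sly_perSlice`, by small subgraph conditioning — `sly_perSlice_of_inputs` fed with the planted
lower bound `sly_planted_lower` of Lemma 3.8, the second-moment bound `slyRatioGen_le_tau` /
`sly_secondMoment_ratio` of Lemma 3.5 and the positivity of the first moment), and the window /
off-window assembly `sly_HT6_of_perSlice`.  Hence `slyGadgetReduction_holds`.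

## References
* [Sly2010] A. Sly, *Computational transition at the uniqueness threshold*, FOCS 2010,
  arXiv:1005.5584, Theorem 2.1, Lemma 2.2, §3 (Lemmas 3.5, 3.7–3.9, Theorem 3.10), §4.
* [MosselWeitzWormald2008] E. Mossel, D. Weitz, N. Wormald, *On the hardness of sampling
  independent sets beyond the tree threshold*, PTRF 143 (2009).
-/

namespace Literature.Computability.Complexity

open Finset Real Literature.Probability.LatticeModels

open scoped Classical in
/-- **Sly's Lemma 3.9** (pointwise lower tail of one slice of the core partition function, by small
subgraph conditioning): for every `θ > 0` there are `χ > 0` and `n₀` such that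
`#{ω : Z_{a,b}(η)(ω) ≤ (2/√n) E Z_{a,b}(η)} ≤ θ |Ω|` for all `n ≥ n₀`, `m' ≤ n^{1/10}`, all boundaries
`η` and all slices `(a,b)` in the `χ`-window around `(p⁺n, p⁻n)`. [cite: Sly2010, Lemma 3.9] -/
theorem sly_perSlice (q : ℕ) (hq : 2 ≤ q) {lam pp pm : ℝ} (hlam : hardCoreThreshold (q + 1) < lam)
    (hpm : 0 < pm) (hlt : pm < pp) (hsum : pp + pm < 1)
    (hEα : lam * (1 - pp - pm) ^ (q + 1) = pp * (1 - pp) ^ (q + 1 - 1))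
    (hEβ : lam * (1 - pp - pm) ^ (q + 1) = pm * (1 - pm) ^ (q + 1 - 1))
    (hρ : (((q + 1 : ℕ) : ℝ) - 1) * pp * pm < (1 - pp) * (1 - pm)) {θ : ℝ} (hθ : 0 < θ) :
    ∃ χ : ℝ, 0 < χ ∧ ∃ n₀ : ℕ, ∀ n : ℕ, n₀ ≤ n → ∀ m' : ℕ, (m' : ℝ) ≤ (n : ℝ) ^ (1 / 10 : ℝ) →
      ∀ (Ep Em : Finset (Fin m')) (a b : ℕ), |(a : ℝ) / n - pp| ≤ χ → |(b : ℝ) / n - pm| ≤ χ →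
        ((univ.filter fun ω : (Fin q → Equiv.Perm (Fin (n + m'))) × Equiv.Perm (Fin n) =>
            ((slyZab n m' q a b Ep Em ω : ℕ) : ℝ) ≤ 2 / Real.sqrt n *
              ((∑ ω' : (Fin q → Equiv.Perm (Fin (n + m'))) × Equiv.Perm (Fin n), ((slyZab n m' q a b Ep Em ω' : ℕ) : ℝ)) /
                Fintype.card ((Fin q → Equiv.Perm (Fin (n + m'))) × Equiv.Perm (Fin n)))).card : ℝ) ≤
          θ * Fintype.card ((Fin q → Equiv.Perm (Fin (n + m'))) × Equiv.Perm (Fin n)) := by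
  have hρ' : (q : ℝ) * (pp * pm) < (1 - pp) * (1 - pm) := by
    have : (((q + 1 : ℕ) : ℝ) - 1) = q := by push_cast; ring
    rw [this] at hρ; linarith [hρ]
  exact sly_perSlice_of_inputs q hq hpm hlt hsum hρ'
    (fun k B ε hε => sly_planted_lower q k B hpm hlt.le hsum hε)
    (sly_secondMoment_input q hpm hlt hsum slyRatioGen (slyTau (q + 1) pp pm)
      (slyRatioGen_le_tau q hq hlam hpm hlt hsum hEα hEβ hρ)
      (fun n m' a b Ep Em h1 h2 => sly_secondMoment_ratio n m' q a b Ep Em h1 h2))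
    (sly_sum_slyZab_pos_window q hpm hlt hsum) hθ

open scoped Classical in
/-- **Sly's Theorem 3.10** (counting form, both phases; the hypothesis `HT6` of
`slyGadgetReduction_of_thm310`; the covering condition is not needed). [cite: Sly2010, Theorem 3.10] -/
theorem sly_thm310 : ∀ (q : ℕ), 2 ≤ q → ∀ (lam : ℝ), hardCoreThreshold (q + 1) < lam →
      (q + 1 = 3 ∨ lam ≤ hardCoreThreshold q) →
      ∃ γ₆ : ℝ, 0 < γ₆ ∧ ∃ n₆ : ℕ, ∀ n : ℕ, n₆ ≤ n → ∀ m' : ℕ, (m' : ℝ) ≤ (n : ℝ) ^ γ₆ →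
      ∀ (s : Bool) (Ep Em : Finset (Fin m')),
        16 * ((univ.filter fun ω : (Fin q → Equiv.Perm (Fin (n + m'))) × Equiv.Perm (Fin n) =>
          (Fintype.card ((Fin q → Equiv.Perm (Fin (n + m'))) × Equiv.Perm (Fin n)) : ℝ) * slyCoreZ ω.1 ω.2 lam s Ep Em <
            (∑ ω' : (Fin q → Equiv.Perm (Fin (n + m'))) × Equiv.Perm (Fin n), slyCoreZ ω'.1 ω'.2 lam s Ep Em) /
              Real.sqrt n).card : ℝ) ≤
          Fintype.card ((Fin q → Equiv.Perm (Fin (n + m'))) × Equiv.Perm (Fin n)) :=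
  fun q hq lam hlam _ => sly_HT6_of_perSlice q hq lam hlam
    (fun hpm hlt hsum hEα hEβ hρ _ hθ => sly_perSlice q hq hlam hpm hlt hsum hEα hEβ hρ hθ)

/-- **Sly's gadget theorem** `slyGadgetReduction` (Theorem 2.1 / Lemma 2.2 of [Sly2010] in the
counting form of `HardcoreInapproximability`), unconditionally. [cite: Sly2010, Theorem 2.1, Lemma 2.2, Theorem 3.10] -/
theorem slyGadgetReduction_holds : slyGadgetReduction := slyGadgetReduction_of_thm310 sly_thm310

end Literature.Computability.Complexity
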